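import Literature.Computability.QuantumComplexity.EntropyCeiling
import HarnessLib

/-!
# The coherent copies floor: how many noisy circuit outputs any joint read-out must consume

Takagi–Tajima–Gu prove that an error-mitigation strategy applied to `N` noisy `M`-qubit layered circuits
(local depolarizing noise of strength `≥ γ` after each of `L` layers), allowed to apply "any coherent
interaction over all distorted states" as its trailing process, and achieving accuracy `δ` with success
probability `1 − ε` on a target set containing two states `ρ, σ` with `D_O(ρ, σ) ≥ 2δ`, needs
`N ≥ (1 − 2ε)² / (2 ln(2) M (1 − γ)^{2L})` samples [cite: TakagiTajimaGu2023, Theorem 3 eq. (5)]. The proof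
(their Appendix F) is four moves: (F2) the trace distance between the two `N`-fold tensor states is at most the
sum of their distances to the maximally mixed state; (F3) quantum Pinsker; (F4) additivity of the relative
entropy over the tensor factors; (F5)–(F7) one noise layer contracts `D(· ‖ 𝟙/2^M)` by `(1−γ)²`.

This module transfers that proof onto the tree's entropy-ceiling vocabulary (`EntropyCeiling`: the deficiency
`D(ρ) = n ln 2 − S(ρ)`, the read-out law `outcomeProb`, the measured Pinsker `tvUniform_le_sqrt_deficiency`,
the depth ceiling `deficiencyCeiling_holds` with the ELEMENTARY rate `(1−p)` per layer). Dictionary: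
`N ↔ N` copies, `M ↔ n = |ι|` qubits, `L ↔ d` layers, `γ ↔ p`, `D_tr ↦` the supremum over joint read-outs
`(V, f)` / effects `E` below, (F3) `↦` R4+R5 of `EntropyCeiling` on the big register, (F4) `↦`
`vonNeumannEntropy_kronecker`, (F5)–(F7) `↦ deficiencyCeiling_holds` copy by copy.

* §0 THE OBJECT. `nCopyState N σ` is the joint state `σ_0 ⊗ ⋯ ⊗ σ_{N−1}` of a family of `n`-qubit states as a
  matrix on the `(Fin N × ι)`-wire register (iterated Kronecker product, re-indexed by the explicit bijection
  `copySplit`; the big register is again of the form `κ → Bool`, so every `EntropyCeiling` lemma applies to it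
  with `κ = Fin N × ι`). It is a density (`isDensity_nCopyState`), its deficiency is ADDITIVE over the copies
  (`entropyDeficiency_nCopyState`, the step (F4)), and read in the product basis its law is the product of the
  per-copy laws (`outcomeProb_nCopyState`: the classical-transcript face; one copy = the single read-out).
* §1 THE COHERENT READ-OUT CLASS. One arbitrary unitary `V` on all `N·n` qubits, then the computational-basis
  read-out, then any statistic `0 ≤ f ≤ 1`: `jointTest_gap_le` bounds `|E_A f − E_B f|` by
  `√(D(A)/2) + √(D(B)/2)` for any two densities on any register ((F2)+(F3)); `effect_gap_le` is the same bound
  for every effect `0 ≤ E ≤ 𝟙` on the register (spectral theorem), i.e. for every two-outcome measurement of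
  the copies however entangling across copies it is; `V = 1` is the shot-by-shot classical read-out
  (`basisTest_gap_le`).
* §2–§3 THE COPIES FLOOR. For `N` noisy circuit outputs per arm (copy `k`: rate `p_k`, depth `d_k`, its own gate
  layers and input; `noisyCopies`) the budget is `D ≤ n ln 2 · Σ_k (1−p_k)^{d_k}` (`deficiency_noisyCopies_le`),
  whence the headline `coherentCopies_gap_le` and the floor `coherentCopies_floor`: a joint read-out accepting
  arm A w.p. `≥ 1−ε` and arm B w.p. `≤ ε` forces `1 − 2ε ≤ √(n ln 2 · B_A/2) + √(n ln 2 · B_B/2)`; with uniform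
  `p, d`: `(1−2ε)² ≤ 2 n ln 2 · N (1−p)^d`, i.e. `N ≥ (1−2ε)²/(2 ln 2 · n · (1−p)^d)`
  (`coherentCopies_floor_uniform`; exponent `d` where print has `2L`), and against the fair-coin
  law `N ≥ 2(1−2ε)²/(n ln 2 (1−p)^d)` (`coherentCopies_floor_coin`).
* §4 THE ACCURACY–CONFIDENCE READING (the print's performance measure (1)). `floor_of_accuracy` /
  `coherentCopies_floor_of_accuracy`: if a real answer `g` read off the copies is `δ`-accurate w.p. `≥ 1−ε` on two
  experiments whose target values differ by more than `2δ`, the two windows are disjoint, the window indicator is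
  a test, and the same floor follows — for whatever coherent processing produced `g`.
* §5 THE SHARP RATE AS A HYPOTHESIS. Under the one-layer contraction by `(1−p)²` (the hypothesis of
  `deficiencyCeiling_sharp_of`; not proved in the tree) the floor is the print's display letter for letter,
  `N ≥ (1−2ε)²/(2 ln(2) n (1−p)^{2d})` (`coherentCopies_floor_sharp_of`). Nothing else consumes that hypothesis.
* §6 NUMBERS. `n = 100`, `p = 10⁻²`, `ε = 1/10`: at depth `d = 1000` any joint read-out telling two admissible
  experiments apart needs `N ≥ 102` copies (`numbers100`); at `d = 500` the floor is `< 1` and says nothing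
  (`numbers100_vacuous`; by arithmetic it is `< 1` for every `d ≤ 535` at these values) — the floor only bites
  beyond the useless depth of the single-copy ceiling and then grows like `e^{pd}(1−2ε)²/(2 n ln 2)`.

HONEST SCOPE. Finite-dimensional inequalities about reading `N` noisy circuit outputs JOINTLY. Per copy the noise
model is the tree's `PauliPath.noisyEvolve` (local depolarizing noise on the input and after every gate layer but
the last; unitary gate layers only — no intermediate unital channels `Λ, Ξ` of the print's Fig. 2, no resets,
no fresh ancillas inside the circuit, no mid-circuit measurements); the family of circuits is fixed in advance
(closed-loop choice of which circuit to run next is not modelled; adaptivity inside the joint measurement is,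
through `E`); measurements assisted by ancillas OUTSIDE the register are covered only in so far as they act
through an effect `E` on the register (Naimark's dilation is not formalised here — `effect_gap_le` quantifies
over `E` directly). The results are LOWER bounds on the number of copies, exponential in `p·d` only, polynomial
in `n`, and empty below the useless depth; they do not reproduce the print's exponent `2L` (except conditionally,
§5), nor its Theorems 1–2 (fidelity, bias–standard-deviation forms), nor its Appendix I (thermal and other noise
models), nor the maximum-spread currency of [cite: TakagiEtAl2022, Theorem 3], nor the `exp(n)` regime of
[cite: QuekEtAl2024, Theorem 1]; they say nothing about whether any protocol attains the floor and nothing about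
error-corrected circuits. No estimator and no procedure is constructed. Nothing here bears on BQP versus BPP.
-/

noncomputable section

namespace Literature.Computability.QuantumComplexity

namespace CoherentCopiesFloor

open Matrix Finset
open scoped BigOperators ComplexOrder Kronecker
open PauliPath EntropyCeiling
open Literature.InformationTheory.Entropy

variable {ι : Type} [Fintype ι] [DecidableEq ι]

/-! ### §0 The object: the joint `N`-copy state on the `(Fin N × ι)`-wire register -/

/-- Splitting the strings on the wires `Fin (N+1) × ι` into (copy `0`'s string, the string on the remaining
`Fin N × ι` wires). [cite: TakagiTajimaGu2023, Appendix F eq. (F2) (the N-fold tensor register)] -/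
def copySplit (N : ℕ) : ((Fin (N + 1) × ι) → Bool) ≃ (ι → Bool) × ((Fin N × ι) → Bool) where
  toFun x := (fun i => x (0, i), fun ki => x (ki.1.succ, ki.2))
  invFun y := fun ki => Fin.cons (α := fun _ : Fin (N + 1) => ι → Bool) y.1 (fun k i => y.2 (k, i)) ki.1 ki.2
  left_inv x := by
    funext ⟨k, i⟩
    refine Fin.cases ?_ (fun k => ?_) k
    · simp
    · simp
  right_inv y := by
    rcases y with ⟨y0, y1⟩
    simp

/-- **The joint `N`-copy state** `σ_0 ⊗ σ_1 ⊗ ⋯ ⊗ σ_{N−1}` of a family of states on the `n`-qubit register,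
as a matrix on the `(Fin N × ι)`-wire register (wire `(k, i)` = wire `i` of copy `k`); `N = 0` is the
trivial one-dimensional state. [cite: TakagiTajimaGu2023, §"Framework" (N distorted states, Fig. 1) and Appendix F eq. (F2)] -/
def nCopyState : (N : ℕ) → (Fin N → Matrix (ι → Bool) (ι → Bool) ℂ) →
    Matrix ((Fin N × ι) → Bool) ((Fin N × ι) → Bool) ℂ
  | 0, _ => 1
  | N + 1, σ => ((σ 0) ⊗ₖ nCopyState N (fun k => σ k.succ)).submatrix (copySplit N) (copySplit N)

omit [DecidableEq ι] in
/-- Unfolding one copy. [cite: TakagiTajimaGu2023, Appendix F eq. (F2)] -/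
theorem nCopyState_succ (N : ℕ) (σ : Fin (N + 1) → Matrix (ι → Bool) (ι → Bool) ℂ) :
    nCopyState (N + 1) σ =
      ((σ 0) ⊗ₖ nCopyState N (fun k => σ k.succ)).submatrix (copySplit N) (copySplit N) := rfl

/-- Re-indexing by a bijection preserves the trace (Mathlib has the `Fintype`-generic square version). [folklore] -/
private theorem trace_submatrix_equiv {m m' : Type} [Fintype m] [Fintype m'] (A : Matrix m m ℂ) (e : m' ≃ m) :
    (A.submatrix e e).trace = A.trace := by
  simp only [Matrix.trace, Matrix.diag, Matrix.submatrix_apply]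
  exact e.sum_comp (fun i => A i i)

/-- **The joint state of densities is a density.** [cite: NielsenChuang2010, §2.4.1 and §2.1.7 (tensor products of density operators)] -/
theorem isDensity_nCopyState : ∀ (N : ℕ) (σ : Fin N → Matrix (ι → Bool) (ι → Bool) ℂ),
    (∀ k, IsDensity (σ k)) → IsDensity (nCopyState N σ)
  | 0, _, _ => by
    refine ⟨Matrix.PosSemidef.one, ?_⟩
    simp [nCopyState, Matrix.trace_one]
  | N + 1, σ, hσ => by
    have ih := isDensity_nCopyState N (fun k => σ k.succ) (fun k => hσ _)
    refine ⟨((hσ 0).1.kronecker ih.1).submatrix _, ?_⟩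
    rw [nCopyState_succ, trace_submatrix_equiv]
    exact trace_kronecker_eq_one (hσ 0).2 ih.2

/-- The trivial register (no wires) carries entropy `0`. [cite: NielsenChuang2010, §11.3 eq. (11.40)] -/
private theorem vonNeumannEntropy_one_trivial :
    vonNeumannEntropy (1 : Matrix ((Fin 0 × ι) → Bool) ((Fin 0 × ι) → Bool) ℂ) = 0 := by
  have h := vonNeumannEntropy_uniform_register (ι := Fin 0 × ι)
  simpa [Fintype.card_fun, Fintype.card_prod] using h

/-- **Additivity of the deficiency over copies**: `D(⊗_k σ_k ‖ 𝟙/2^{Nn}) = Σ_k D(σ_k ‖ 𝟙/2ⁿ)`, i.e.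
`Nn ln 2 − S(⊗_k σ_k) = Σ_k (n ln 2 − S(σ_k))` — the additivity step (F4) of the printed proof.
[cite: TakagiTajimaGu2023, Appendix F eq. (F4) (additivity of the relative entropy)] [cite: NielsenChuang2010, Theorem 11.8 (5) (S(ρ ⊗ σ) = S(ρ) + S(σ))] -/
theorem entropyDeficiency_nCopyState : ∀ (N : ℕ) (σ : Fin N → Matrix (ι → Bool) (ι → Bool) ℂ),
    (∀ k, IsDensity (σ k)) → entropyDeficiency (nCopyState N σ) = ∑ k, entropyDeficiency (σ k)
  | 0, _, _ => by
    simp [entropyDeficiency, nCopyState, vonNeumannEntropy_one_trivial]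
  | N + 1, σ, hσ => by
    have ih := entropyDeficiency_nCopyState N (fun k => σ k.succ) (fun k => hσ _)
    have hd := isDensity_nCopyState N (fun k => σ k.succ) (fun k => hσ _)
    have hS : vonNeumannEntropy (nCopyState (N + 1) σ) =
        vonNeumannEntropy (σ 0) + vonNeumannEntropy (nCopyState N (fun k => σ k.succ)) := by
      rw [nCopyState_succ, vonNeumannEntropy_submatrix_equiv ((hσ 0).1.kronecker hd.1).1,
        vonNeumannEntropy_kronecker (hσ 0).1.1 hd.1.1 (hσ 0).2 hd.2]
    simp only [entropyDeficiency] at ih ⊢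
    rw [hS, Fin.sum_univ_succ, ← ih]
    simp only [Fintype.card_prod, Fintype.card_fin]
    push_cast
    ring

/-- **Product-basis bridge**: read in the computational basis WITHOUT a joint unitary, the joint state's
outcome law is the product of the per-copy outcome laws, `q(x) = ∏_k q_k(x_k)` — the classical-transcript
face of the object (one copy: the single read-out of the noisy circuit).
[cite: NielsenChuang2010, §2.2.8 (composite systems: measurement statistics of product states)] -/
theorem outcomeProb_nCopyState : ∀ (N : ℕ) (σ : Fin N → Matrix (ι → Bool) (ι → Bool) ℂ),
    (∀ k, IsDensity (σ k)) → ∀ x : (Fin N × ι) → Bool,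
      outcomeProb (nCopyState N σ) x = ∏ k, outcomeProb (σ k) (fun i => x (k, i))
  | 0, _, _, x => by simp [outcomeProb, nCopyState]
  | N + 1, σ, hσ, x => by
    have ih := outcomeProb_nCopyState N (fun k => σ k.succ) (fun k => hσ _) (fun ki => x (ki.1.succ, ki.2))
    have hd := isDensity_nCopyState N (fun k => σ k.succ) (fun k => hσ _)
    rw [Fin.prod_univ_succ, ← ih]
    simp only [outcomeProb, nCopyState_succ, Matrix.submatrix_apply, Matrix.kroneckerMap_apply]
    have h0 := (hσ 0).1.1.coe_re_apply_self (fun i => x (0, i))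
    have h1 := hd.1.1.coe_re_apply_self (fun ki : Fin N × ι => x (ki.1.succ, ki.2))
    simp only [RCLike.re_to_complex] at h0 h1
    show ((σ 0) (fun i => x (0, i)) (fun i => x (0, i)) *
        nCopyState N (fun k => σ k.succ) (fun ki => x (ki.1.succ, ki.2)) (fun ki => x (ki.1.succ, ki.2))).re = _
    rw [← h0, ← h1]
    simp [Complex.mul_re]

/-- **One copy is the single read-out**: `q_{nCopyState 1 σ}(x) = q_{σ_0}(x_0)` (cheapest-falsifier check (i)).
[cite: NielsenChuang2010, §2.2.8] -/
theorem outcomeProb_nCopyState_one (σ : Fin 1 → Matrix (ι → Bool) (ι → Bool) ℂ) (hσ : ∀ k, IsDensity (σ k))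
    (x : (Fin 1 × ι) → Bool) : outcomeProb (nCopyState 1 σ) x = outcomeProb (σ 0) (fun i => x (0, i)) := by
  rw [outcomeProb_nCopyState 1 σ hσ x, Fin.prod_univ_one]

/-! ### §1 The coherent two-arm test gap (any register, any joint unitary, any soft statistic) -/

/-- **Coherent two-arm test gap.** For densities `A`, `B` on a `κ`-wire register, ANY unitary `V` on the whole
register followed by the computational-basis read-out, and ANY statistic `f` with `0 ≤ f ≤ 1`:
`|E_A f − E_B f| ≤ √(D(A)/2) + √(D(B)/2)` with `D` the entropy deficiency — the triangle inequality through
the uniform law (F2) and Pinsker (F3) of the printed proof, with the tree's measured-deficiency Pinsker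
(`tvUniform_le_sqrt_deficiency`) and `boundedTestGap_holds` on the big register, and unitary invariance of `D`.
[cite: TakagiTajimaGu2023, Appendix F eqs. (F2)–(F3)] [cite: NielsenChuang2010, §9.2.1 Theorem 9.1 / eq. (9.22) (no measurement beats the trace distance)] -/
theorem jointTest_gap_le {κ : Type} [Fintype κ] [DecidableEq κ]
    {A B : Matrix (κ → Bool) (κ → Bool) ℂ} (hA : IsDensity A) (hB : IsDensity B)
    {V : Matrix (κ → Bool) (κ → Bool) ℂ} (hV : V ∈ Matrix.unitaryGroup (κ → Bool) ℂ)
    (f : (κ → Bool) → ℝ) (hf0 : ∀ x, 0 ≤ f x) (hf1 : ∀ x, f x ≤ 1) :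
    |∑ x, outcomeProb (V * A * Vᴴ) x * f x - ∑ x, outcomeProb (V * B * Vᴴ) x * f x| ≤
      Real.sqrt (entropyDeficiency A / 2) + Real.sqrt (entropyDeficiency B / 2) := by
  have hA' := isDensity_unitary_conj hV hA
  have hB' := isDensity_unitary_conj hV hB
  have h1 := boundedTestGap_holds κ (outcomeProb (V * A * Vᴴ)) (sum_outcomeProb hA') f hf0 hf1
  have h2 := boundedTestGap_holds κ (outcomeProb (V * B * Vᴴ)) (sum_outcomeProb hB') f hf0 hf1
  have h3 := tvUniform_le_sqrt_deficiency hA'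
  have h4 := tvUniform_le_sqrt_deficiency hB'
  rw [entropyDeficiency_unitary_conj hV hA.1.1] at h3
  rw [entropyDeficiency_unitary_conj hV hB.1.1] at h4
  set u : ℝ := ∑ x, ((2 : ℝ) ^ Fintype.card κ)⁻¹ * f x
  calc |∑ x, outcomeProb (V * A * Vᴴ) x * f x - ∑ x, outcomeProb (V * B * Vᴴ) x * f x|
      = |(∑ x, outcomeProb (V * A * Vᴴ) x * f x - u) - (∑ x, outcomeProb (V * B * Vᴴ) x * f x - u)| := by
        ring_nf
    _ ≤ |∑ x, outcomeProb (V * A * Vᴴ) x * f x - u| + |∑ x, outcomeProb (V * B * Vᴴ) x * f x - u| :=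
        abs_sub _ _
    _ ≤ Real.sqrt (entropyDeficiency A / 2) + Real.sqrt (entropyDeficiency B / 2) :=
        add_le_add (h1.trans h3) (h2.trans h4)

/-- **Budget form**: if `D(A) ≤ a` and `D(B) ≤ b` then the coherent test gap is `≤ √(a/2) + √(b/2)`.
[cite: TakagiTajimaGu2023, Appendix F eqs. (F2)–(F4)] -/
theorem jointTest_gap_le_of_budget {κ : Type} [Fintype κ] [DecidableEq κ]
    {A B : Matrix (κ → Bool) (κ → Bool) ℂ} (hA : IsDensity A) (hB : IsDensity B) {a b : ℝ}
    (ha : entropyDeficiency A ≤ a) (hb : entropyDeficiency B ≤ b)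
    {V : Matrix (κ → Bool) (κ → Bool) ℂ} (hV : V ∈ Matrix.unitaryGroup (κ → Bool) ℂ)
    (f : (κ → Bool) → ℝ) (hf0 : ∀ x, 0 ≤ f x) (hf1 : ∀ x, f x ≤ 1) :
    |∑ x, outcomeProb (V * A * Vᴴ) x * f x - ∑ x, outcomeProb (V * B * Vᴴ) x * f x| ≤
      Real.sqrt (a / 2) + Real.sqrt (b / 2) :=
  (jointTest_gap_le hA hB hV f hf0 hf1).trans (add_le_add
    (Real.sqrt_le_sqrt (by linarith)) (Real.sqrt_le_sqrt (by linarith)))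

/-- **One arm against the coin law.** A single joint state `A` read by `(V, f)` is within `√(D(A)/2)` of the
fair-coin expectation `2^{−|κ|} Σ_x f(x)`. [cite: TakagiTajimaGu2023, Appendix F eqs. (F3)–(F4)] [cite: FrancaGarciaPatron2021, Supplementary §6.1.1 (Pinsker)] -/
theorem jointTest_gap_uniform_le {κ : Type} [Fintype κ] [DecidableEq κ]
    {A : Matrix (κ → Bool) (κ → Bool) ℂ} (hA : IsDensity A)
    {V : Matrix (κ → Bool) (κ → Bool) ℂ} (hV : V ∈ Matrix.unitaryGroup (κ → Bool) ℂ)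
    (f : (κ → Bool) → ℝ) (hf0 : ∀ x, 0 ≤ f x) (hf1 : ∀ x, f x ≤ 1) :
    |∑ x, outcomeProb (V * A * Vᴴ) x * f x - ∑ x, ((2 : ℝ) ^ Fintype.card κ)⁻¹ * f x| ≤
      Real.sqrt (entropyDeficiency A / 2) := by
  have hA' := isDensity_unitary_conj hV hA
  have h1 := boundedTestGap_holds κ (outcomeProb (V * A * Vᴴ)) (sum_outcomeProb hA') f hf0 hf1
  have h3 := tvUniform_le_sqrt_deficiency hA'
  rw [entropyDeficiency_unitary_conj hV hA.1.1] at h3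
  exact h1.trans h3

/-- **The `V = 1` face (shot-by-shot classical read-out).** Without a joint unitary the bound reads
`|Σ_x q_A(x) f(x) − Σ_x q_B(x) f(x)| ≤ √(D(A)/2) + √(D(B)/2)`; with `outcomeProb_nCopyState` (product law) this
is the classical-transcript test ceiling, and for one copy the single-read-out ceiling R6/R7 of `EntropyCeiling`.
[cite: FrancaGarciaPatron2021, Supplementary §6.1.1] [cite: TakagiTajimaGu2023, Appendix F eq. (F2)] -/
theorem basisTest_gap_le {κ : Type} [Fintype κ] [DecidableEq κ]
    {A B : Matrix (κ → Bool) (κ → Bool) ℂ} (hA : IsDensity A) (hB : IsDensity B)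
    (f : (κ → Bool) → ℝ) (hf0 : ∀ x, 0 ≤ f x) (hf1 : ∀ x, f x ≤ 1) :
    |∑ x, outcomeProb A x * f x - ∑ x, outcomeProb B x * f x| ≤
      Real.sqrt (entropyDeficiency A / 2) + Real.sqrt (entropyDeficiency B / 2) := by
  simpa using jointTest_gap_le hA hB (Submonoid.one_mem _) f hf0 hf1

/-! ### §1b The effect form: every effect `0 ≤ E ≤ 1` on the register (the `D_tr` face of (F2)) -/

/-- **Effect form of the coherent test gap.** For densities `A`, `B` on a register and ANY effect `E`
(`E ⪰ 0`, `𝟙 − E ⪰ 0`): `|Re tr(E A) − Re tr(E B)| ≤ √(D(A)/2) + √(D(B)/2)`. The spectral theorem writes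
`E = U diag(λ) U⋆` with `λ ∈ [0,1]`, so `tr(E X) = Σ_x λ_x ⟨x|U⋆ X U|x⟩` and this is `jointTest_gap_le` with
`V = U⋆`, `f = λ`: every two-outcome measurement on the copies acts through such an `E`.
[cite: TakagiTajimaGu2023, §"Sampling lower bounds" (O = {A : 0 ≤ A ≤ I} gives D_tr) and Appendix F eq. (F2)] [cite: NielsenChuang2010, §2.2.6 (POVM elements) and Theorem 9.1] -/
theorem effect_gap_le {κ : Type} [Fintype κ] [DecidableEq κ]
    {A B : Matrix (κ → Bool) (κ → Bool) ℂ} (hA : IsDensity A) (hB : IsDensity B)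
    {E : Matrix (κ → Bool) (κ → Bool) ℂ} (hE0 : E.PosSemidef) (hE1 : (1 - E).PosSemidef) :
    |((E * A).trace).re - ((E * B).trace).re| ≤
      Real.sqrt (entropyDeficiency A / 2) + Real.sqrt (entropyDeficiency B / 2) := by
  set U : Matrix (κ → Bool) (κ → Bool) ℂ := (hE0.1.eigenvectorUnitary : Matrix (κ → Bool) (κ → Bool) ℂ) with hU
  set Λ : (κ → Bool) → ℝ := hE0.1.eigenvalues with hΛ
  have hUmem : U ∈ Matrix.unitaryGroup (κ → Bool) ℂ := hE0.1.eigenvectorUnitary.2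
  have hVmem : star U ∈ Matrix.unitaryGroup (κ → Bool) ℂ := Unitary.star_mem hUmem
  have hUU : star U * U = 1 := Matrix.mem_unitaryGroup_iff'.mp hUmem
  have hE : E = U * diagonal (fun x => (Λ x : ℂ)) * star U := by
    have h := hE0.1.spectral_theorem
    rw [Unitary.conjStarAlgAut_apply] at h
    exact h
  -- `Re tr(E M) = Σ_x λ_x · ⟨x| U⋆ M U |x⟩`
  have key : ∀ M : Matrix (κ → Bool) (κ → Bool) ℂ,
      ((E * M).trace).re = ∑ x, outcomeProb (star U * M * (star U)ᴴ) x * Λ x := by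
    intro M
    have hc : (star U)ᴴ = U := by rw [Matrix.star_eq_conjTranspose, Matrix.conjTranspose_conjTranspose]
    rw [hc, hE]
    have ht : (U * diagonal (fun x => (Λ x : ℂ)) * star U * M).trace =
        (diagonal (fun x => (Λ x : ℂ)) * (star U * M * U)).trace := by
      rw [Matrix.mul_assoc, Matrix.mul_assoc, Matrix.trace_mul_comm]; simp only [Matrix.mul_assoc]
    rw [ht]
    simp only [Matrix.trace, Matrix.diag_apply, Matrix.diagonal_mul, Complex.re_sum, Complex.re_ofReal_mul,
      outcomeProb]
    exact Finset.sum_congr rfl fun x _ => mul_comm _ _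
  -- `0 ≤ λ ≤ 1`
  have hΛ0 : ∀ x, 0 ≤ Λ x := fun x => hE0.eigenvalues_nonneg x
  have hΛ1 : ∀ x, Λ x ≤ 1 := by
    intro x
    have hP := hE1.mul_mul_conjTranspose_same (star U)
    have hc : (star U)ᴴ = U := by rw [Matrix.star_eq_conjTranspose, Matrix.conjTranspose_conjTranspose]
    have hid : star U * (1 - E) * (star U)ᴴ = 1 - diagonal (fun x => (Λ x : ℂ)) := by
      rw [hc, Matrix.mul_sub, Matrix.sub_mul, Matrix.mul_one, hUU, hE]
      congr 1
      calc star U * (U * diagonal (fun x => (Λ x : ℂ)) * star U) * U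
          = (star U * U) * diagonal (fun x => (Λ x : ℂ)) * (star U * U) := by simp only [Matrix.mul_assoc]
        _ = diagonal (fun x => (Λ x : ℂ)) := by rw [hUU, Matrix.one_mul, Matrix.mul_one]
    rw [hid] at hP
    have hx := hP.diag_nonneg (i := x)
    rw [Matrix.sub_apply, Matrix.one_apply_eq, Matrix.diagonal_apply_eq] at hx
    have := (Complex.nonneg_iff.mp hx).1
    simpa using this
  rw [key A, key B]
  exact jointTest_gap_le hA hB hVmem Λ hΛ0 hΛ1

/-- The rank-one effect `|x⟩⟨x|` returns the read-out probability: `Re tr(|x⟩⟨x| A) = q_A(x)` (cheapest-falsifier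
check (iii) of the line). [cite: NielsenChuang2010, §2.2.5 (p(m) = tr(P_m ρ))] -/
theorem effect_proj_eq_outcomeProb {κ : Type} [Fintype κ] [DecidableEq κ]
    (A : Matrix (κ → Bool) (κ → Bool) ℂ) (x : κ → Bool) : ((proj x * A).trace).re = outcomeProb A x := by
  rw [trace_proj_mul, outcomeProb]

/-! ### §2 Noisy copies: the per-copy deficiency budget `n ln 2 · Σ_k (1 − p_k)^{d_k}` -/

/-- **The joint state of `N` noisy circuit outputs** (copy `k`: noise rate `p_k`, depth `d_k`, gate layers `U_k`,
input `ρ_k`; each copy is the tree's `noisyEvolve`). [cite: TakagiTajimaGu2023, Theorem 3 (N noisy layered circuits) and Appendix F eq. (F1)] -/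
def noisyCopies (N : ℕ) (p : Fin N → ℝ) (d : Fin N → ℕ)
    (U : (k : Fin N) → Fin (d k) → Matrix (ι → Bool) (ι → Bool) ℂ)
    (ρ : Fin N → Matrix (ι → Bool) (ι → Bool) ℂ) : Matrix ((Fin N × ι) → Bool) ((Fin N × ι) → Bool) ℂ :=
  nCopyState N (fun k => noisyEvolve (p k : ℂ) (d k) (U k) (ρ k))

/-- The joint state of noisy copies is a density. [cite: TakagiTajimaGu2023, Appendix F eq. (F1)] -/
theorem isDensity_noisyCopies (N : ℕ) {p : Fin N → ℝ} (hp0 : ∀ k, 0 ≤ p k) (hp1 : ∀ k, p k ≤ 1)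
    (d : Fin N → ℕ) {U : (k : Fin N) → Fin (d k) → Matrix (ι → Bool) (ι → Bool) ℂ}
    (hU : ∀ k t, U k t ∈ Matrix.unitaryGroup (ι → Bool) ℂ)
    {ρ : Fin N → Matrix (ι → Bool) (ι → Bool) ℂ} (hρ : ∀ k, IsDensity (ρ k)) :
    IsDensity (noisyCopies N p d U ρ) :=
  isDensity_nCopyState N _ fun k => isDensity_noisyEvolve (hp0 k) (hp1 k) (d k) (U k) (hU k) (hρ k)

/-- **The copies budget** (elementary rate): `D(⊗_k σ_k) ≤ n ln 2 · Σ_k (1 − p_k)^{d_k}` — additivity over the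
copies, the tree's depth ceiling `deficiencyCeiling_holds` per copy (rate `(1−p)` per layer where print has
`(1−γ)²`), and `D(ρ_k) ≤ n ln 2`; this is (F4)+(F7) of the printed proof.
[cite: TakagiTajimaGu2023, Appendix F eqs. (F4)–(F7)] [cite: FrancaGarciaPatron2021, Lemma 1] -/
theorem deficiency_noisyCopies_le (N : ℕ) {p : Fin N → ℝ} (hp0 : ∀ k, 0 ≤ p k) (hp1 : ∀ k, p k ≤ 1)
    (d : Fin N → ℕ) {U : (k : Fin N) → Fin (d k) → Matrix (ι → Bool) (ι → Bool) ℂ}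
    (hU : ∀ k t, U k t ∈ Matrix.unitaryGroup (ι → Bool) ℂ)
    {ρ : Fin N → Matrix (ι → Bool) (ι → Bool) ℂ} (hρ : ∀ k, IsDensity (ρ k)) :
    entropyDeficiency (noisyCopies N p d U ρ) ≤ Fintype.card ι * Real.log 2 * ∑ k, (1 - p k) ^ d k := by
  have hσ : ∀ k, IsDensity (noisyEvolve (p k : ℂ) (d k) (U k) (ρ k)) :=
    fun k => isDensity_noisyEvolve (hp0 k) (hp1 k) (d k) (U k) (hU k) (hρ k)
  rw [noisyCopies, entropyDeficiency_nCopyState N _ hσ, Finset.mul_sum]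
  refine Finset.sum_le_sum fun k _ => ?_
  have h1 := deficiencyCeiling_holds ι (p k) (hp0 k) (hp1 k) (d k) (U k) (hU k) (ρ k) (hρ k)
  have h2 := entropyDeficiency_le (hρ k)
  have h3 : 0 ≤ (1 - p k) ^ d k := pow_nonneg (by linarith [hp1 k]) _
  calc entropyDeficiency (noisyEvolve (p k : ℂ) (d k) (U k) (ρ k))
      ≤ (1 - p k) ^ d k * entropyDeficiency (ρ k) := h1
    _ ≤ (1 - p k) ^ d k * (Fintype.card ι * Real.log 2) := mul_le_mul_of_nonneg_left h2 h3
    _ = Fintype.card ι * Real.log 2 * (1 - p k) ^ d k := by ring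

/-- Squaring step: `0 ≤ 1 − 2ε ≤ 2√X` gives `(1−2ε)² ≤ 4X`. [folklore] -/
private theorem sq_le_four_mul {ε X : ℝ} (hX0 : 0 ≤ X) (hε : ε ≤ 1 / 2) (h : 1 - 2 * ε ≤ 2 * Real.sqrt X) :
    (1 - 2 * ε) ^ 2 ≤ 4 * X := by
  calc (1 - 2 * ε) ^ 2 ≤ (2 * Real.sqrt X) ^ 2 := pow_le_pow_left₀ (by linarith) h 2
    _ = 4 * X := by rw [mul_pow, Real.sq_sqrt hX0]; ring

/-! ### §3 The headline: the coherent test gap and the copies floor -/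

/-- **Coherent copies test gap (headline).** Two arms — `N` noisy circuit outputs each (arm A: rates `p`, depths `d`,
layers `U`, inputs `ρ`; arm B: `p'`, `d'`, `U'`, `ρ'`) — read by ONE arbitrary joint unitary `V` on all `N·n` qubits,
the computational-basis read-out and any statistic `0 ≤ f ≤ 1`:
`|E_A f − E_B f| ≤ √(n ln 2 · Σ_k (1−p_k)^{d_k} / 2) + √(n ln 2 · Σ_k (1−p'_k)^{d'_k} / 2)`.
[cite: TakagiTajimaGu2023, Appendix F eq. (F8)] -/
theorem coherentCopies_gap_le (N : ℕ)
    {p : Fin N → ℝ} (hp0 : ∀ k, 0 ≤ p k) (hp1 : ∀ k, p k ≤ 1) (d : Fin N → ℕ)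
    {U : (k : Fin N) → Fin (d k) → Matrix (ι → Bool) (ι → Bool) ℂ} (hU : ∀ k t, U k t ∈ Matrix.unitaryGroup (ι → Bool) ℂ)
    {ρ : Fin N → Matrix (ι → Bool) (ι → Bool) ℂ} (hρ : ∀ k, IsDensity (ρ k))
    {p' : Fin N → ℝ} (hp0' : ∀ k, 0 ≤ p' k) (hp1' : ∀ k, p' k ≤ 1) (d' : Fin N → ℕ)
    {U' : (k : Fin N) → Fin (d' k) → Matrix (ι → Bool) (ι → Bool) ℂ} (hU' : ∀ k t, U' k t ∈ Matrix.unitaryGroup (ι → Bool) ℂ)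
    {ρ' : Fin N → Matrix (ι → Bool) (ι → Bool) ℂ} (hρ' : ∀ k, IsDensity (ρ' k))
    {V : Matrix ((Fin N × ι) → Bool) ((Fin N × ι) → Bool) ℂ} (hV : V ∈ Matrix.unitaryGroup ((Fin N × ι) → Bool) ℂ)
    (f : ((Fin N × ι) → Bool) → ℝ) (hf0 : ∀ x, 0 ≤ f x) (hf1 : ∀ x, f x ≤ 1) :
    |∑ x, outcomeProb (V * noisyCopies N p d U ρ * Vᴴ) x * f x -
        ∑ x, outcomeProb (V * noisyCopies N p' d' U' ρ' * Vᴴ) x * f x| ≤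
      Real.sqrt (Fintype.card ι * Real.log 2 * (∑ k, (1 - p k) ^ d k) / 2) +
        Real.sqrt (Fintype.card ι * Real.log 2 * (∑ k, (1 - p' k) ^ d' k) / 2) :=
  jointTest_gap_le_of_budget (isDensity_noisyCopies N hp0 hp1 d hU hρ) (isDensity_noisyCopies N hp0' hp1' d' hU' hρ')
    (deficiency_noisyCopies_le N hp0 hp1 d hU hρ) (deficiency_noisyCopies_le N hp0' hp1' d' hU' hρ') hV f hf0 hf1

/-- **Copies floor, budget form.** If the joint read-out `(V, f)` accepts arm A with probability `≥ 1 − ε` and arm B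
with probability `≤ ε`, then `1 − 2ε ≤ √(n ln 2 · B_A / 2) + √(n ln 2 · B_B / 2)`, `B = Σ_k (1−p_k)^{d_k}`.
(`ε` is unrestricted: for `ε ≥ 1/2` the left side is `≤ 0` and the statement is empty.)
[cite: TakagiTajimaGu2023, Theorem 3 eq. (5) and Appendix F eqs. (F8)–(F9)] -/
theorem coherentCopies_floor (N : ℕ)
    {p : Fin N → ℝ} (hp0 : ∀ k, 0 ≤ p k) (hp1 : ∀ k, p k ≤ 1) (d : Fin N → ℕ)
    {U : (k : Fin N) → Fin (d k) → Matrix (ι → Bool) (ι → Bool) ℂ} (hU : ∀ k t, U k t ∈ Matrix.unitaryGroup (ι → Bool) ℂ)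
    {ρ : Fin N → Matrix (ι → Bool) (ι → Bool) ℂ} (hρ : ∀ k, IsDensity (ρ k))
    {p' : Fin N → ℝ} (hp0' : ∀ k, 0 ≤ p' k) (hp1' : ∀ k, p' k ≤ 1) (d' : Fin N → ℕ)
    {U' : (k : Fin N) → Fin (d' k) → Matrix (ι → Bool) (ι → Bool) ℂ} (hU' : ∀ k t, U' k t ∈ Matrix.unitaryGroup (ι → Bool) ℂ)
    {ρ' : Fin N → Matrix (ι → Bool) (ι → Bool) ℂ} (hρ' : ∀ k, IsDensity (ρ' k))
    {V : Matrix ((Fin N × ι) → Bool) ((Fin N × ι) → Bool) ℂ} (hV : V ∈ Matrix.unitaryGroup ((Fin N × ι) → Bool) ℂ)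
    (f : ((Fin N × ι) → Bool) → ℝ) (hf0 : ∀ x, 0 ≤ f x) (hf1 : ∀ x, f x ≤ 1) {ε : ℝ}
    (hAcc : 1 - ε ≤ ∑ x, outcomeProb (V * noisyCopies N p d U ρ * Vᴴ) x * f x)
    (hRej : ∑ x, outcomeProb (V * noisyCopies N p' d' U' ρ' * Vᴴ) x * f x ≤ ε) :
    1 - 2 * ε ≤ Real.sqrt (Fintype.card ι * Real.log 2 * (∑ k, (1 - p k) ^ d k) / 2) +
      Real.sqrt (Fintype.card ι * Real.log 2 * (∑ k, (1 - p' k) ^ d' k) / 2) := by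
  have h := coherentCopies_gap_le N hp0 hp1 d hU hρ hp0' hp1' d' hU' hρ' hV f hf0 hf1
  have := le_abs_self (∑ x, outcomeProb (V * noisyCopies N p d U ρ * Vᴴ) x * f x -
    ∑ x, outcomeProb (V * noisyCopies N p' d' U' ρ' * Vᴴ) x * f x)
  linarith

/-- **Copies floor, uniform noise and depth (TTG23's display at the tree's elementary rate).** With every copy of
both arms at rate `p` and depth `d` (circuits and inputs still arbitrary per copy), a joint read-out accepting arm A
w.p. `≥ 1 − ε` and arm B w.p. `≤ ε`, `ε ≤ 1/2`, forces `(1 − 2ε)² ≤ 2 · n ln 2 · N · (1−p)^d`, i.e.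
`N ≥ (1−2ε)² / (2 ln 2 · n · (1−p)^d)` — print: `N ≥ (1−2ε)²/(2 ln 2 · M (1−γ)^{2L})`, dictionary `M ↔ n`,
`γ ↔ p`, `L ↔ d`, exponent `d` here for the printed `2L` (sharp rate: `coherentCopies_floor_sharp_of`).
[cite: TakagiTajimaGu2023, Theorem 3 eq. (5) / Appendix F eq. (F9)] -/
theorem coherentCopies_floor_uniform (N : ℕ) {p : ℝ} (hp0 : 0 ≤ p) (hp1 : p ≤ 1) (d : ℕ)
    {U : Fin N → Fin d → Matrix (ι → Bool) (ι → Bool) ℂ} (hU : ∀ k t, U k t ∈ Matrix.unitaryGroup (ι → Bool) ℂ)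
    {ρ : Fin N → Matrix (ι → Bool) (ι → Bool) ℂ} (hρ : ∀ k, IsDensity (ρ k))
    {U' : Fin N → Fin d → Matrix (ι → Bool) (ι → Bool) ℂ} (hU' : ∀ k t, U' k t ∈ Matrix.unitaryGroup (ι → Bool) ℂ)
    {ρ' : Fin N → Matrix (ι → Bool) (ι → Bool) ℂ} (hρ' : ∀ k, IsDensity (ρ' k))
    {V : Matrix ((Fin N × ι) → Bool) ((Fin N × ι) → Bool) ℂ} (hV : V ∈ Matrix.unitaryGroup ((Fin N × ι) → Bool) ℂ)
    (f : ((Fin N × ι) → Bool) → ℝ) (hf0 : ∀ x, 0 ≤ f x) (hf1 : ∀ x, f x ≤ 1) {ε : ℝ} (hε : ε ≤ 1 / 2)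
    (hAcc : 1 - ε ≤ ∑ x, outcomeProb (V * noisyCopies N (fun _ => p) (fun _ => d) U ρ * Vᴴ) x * f x)
    (hRej : ∑ x, outcomeProb (V * noisyCopies N (fun _ => p) (fun _ => d) U' ρ' * Vᴴ) x * f x ≤ ε) :
    (1 - 2 * ε) ^ 2 ≤ 2 * (Fintype.card ι * Real.log 2) * N * (1 - p) ^ d := by
  have h := coherentCopies_floor N (fun _ => hp0) (fun _ => hp1) (fun _ => d) hU hρ
    (fun _ => hp0) (fun _ => hp1) (fun _ => d) hU' hρ' hV f hf0 hf1 hAcc hRej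
  simp only [Finset.sum_const, Finset.card_univ, Fintype.card_fin, nsmul_eq_mul] at h
  set X : ℝ := Fintype.card ι * Real.log 2 * (N * (1 - p) ^ d) / 2 with hX
  have hX0 : 0 ≤ X := by
    have := Real.log_pos one_lt_two
    have : 0 ≤ (1 - p) ^ d := pow_nonneg (by linarith) _
    positivity
  have h4 := sq_le_four_mul hX0 hε (by linarith)
  rw [hX] at h4
  linarith

/-- **One-sided floor against the coin law.** If the joint read-out accepts the `N` noisy copies w.p. `≥ 1 − ε` while
the fair-coin law on the `N·n` output bits accepts w.p. `≤ ε` (`ε ≤ 1/2`), then `(1−2ε)² ≤ n ln 2 · N (1−p)^d / 2`, i.e.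
`N ≥ 2(1−2ε)²/(n ln 2 (1−p)^d)`. [cite: TakagiTajimaGu2023, Appendix F eqs. (F4), (F7)] [cite: FrancaGarciaPatron2021, Supplementary §6.1.1] -/
theorem coherentCopies_floor_coin (N : ℕ) {p : ℝ} (hp0 : 0 ≤ p) (hp1 : p ≤ 1) (d : ℕ)
    {U : Fin N → Fin d → Matrix (ι → Bool) (ι → Bool) ℂ} (hU : ∀ k t, U k t ∈ Matrix.unitaryGroup (ι → Bool) ℂ)
    {ρ : Fin N → Matrix (ι → Bool) (ι → Bool) ℂ} (hρ : ∀ k, IsDensity (ρ k))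
    {V : Matrix ((Fin N × ι) → Bool) ((Fin N × ι) → Bool) ℂ} (hV : V ∈ Matrix.unitaryGroup ((Fin N × ι) → Bool) ℂ)
    (f : ((Fin N × ι) → Bool) → ℝ) (hf0 : ∀ x, 0 ≤ f x) (hf1 : ∀ x, f x ≤ 1) {ε : ℝ} (hε : ε ≤ 1 / 2)
    (hAcc : 1 - ε ≤ ∑ x, outcomeProb (V * noisyCopies N (fun _ => p) (fun _ => d) U ρ * Vᴴ) x * f x)
    (hRej : ∑ x, ((2 : ℝ) ^ Fintype.card (Fin N × ι))⁻¹ * f x ≤ ε) :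
    (1 - 2 * ε) ^ 2 ≤ (Fintype.card ι * Real.log 2) * N * (1 - p) ^ d / 2 := by
  have hA := isDensity_noisyCopies N (fun _ => hp0) (fun _ => hp1) (fun _ => d) hU hρ
  have hB := deficiency_noisyCopies_le N (fun _ => hp0) (fun _ => hp1) (fun _ => d) hU hρ
  simp only [Finset.sum_const, Finset.card_univ, Fintype.card_fin, nsmul_eq_mul] at hB
  have h1 := jointTest_gap_uniform_le hA hV f hf0 hf1
  have h2 := le_abs_self (∑ x, outcomeProb (V * noisyCopies N (fun _ => p) (fun _ => d) U ρ * Vᴴ) x * f x -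
    ∑ x, ((2 : ℝ) ^ Fintype.card (Fin N × ι))⁻¹ * f x)
  set X : ℝ := Fintype.card ι * Real.log 2 * (N * (1 - p) ^ d) / 2 with hX
  have hX0 : 0 ≤ X := by
    have := Real.log_pos one_lt_two
    have : 0 ≤ (1 - p) ^ d := pow_nonneg (by linarith) _
    positivity
  have h3 : Real.sqrt (entropyDeficiency (noisyCopies N (fun _ => p) (fun _ => d) U ρ) / 2) ≤ Real.sqrt X :=
    Real.sqrt_le_sqrt (by rw [hX]; linarith)
  have h4 := pow_le_pow_left₀ (by linarith : 0 ≤ 1 - 2 * ε) (by linarith : 1 - 2 * ε ≤ Real.sqrt X) 2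
  rw [Real.sq_sqrt hX0, hX] at h4
  linarith

/-! ### §4 The accuracy–confidence reading (performance measure (1) of the print) -/

/-- **Estimation forces a test.** For densities `A`, `B` on a register with deficiency budgets `a`, `b`, a joint
read-out `V` and ANY real statistic `g` of the outcome: if `g` lands within `δ` of `t_A` w.p. `≥ 1−ε` under `A` and
within `δ` of `t_B` w.p. `≥ 1−ε` under `B`, with `|t_A − t_B| > 2δ`, then the two windows are disjoint events and
the window indicator is a test, so `1 − 2ε ≤ √(a/2) + √(b/2)` — the hypothesis "(1) with accuracy δ, success
probability 1−ε and D_O(ρ,σ) ≥ 2δ" of the print. [cite: TakagiTajimaGu2023, Theorem 1 (accuracy δ, success probability 1−ε) and Appendix A eq. (A5)] -/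
theorem floor_of_accuracy {κ : Type} [Fintype κ] [DecidableEq κ]
    {A B : Matrix (κ → Bool) (κ → Bool) ℂ} (hA : IsDensity A) (hB : IsDensity B) {a b : ℝ}
    (ha : entropyDeficiency A ≤ a) (hb : entropyDeficiency B ≤ b)
    {V : Matrix (κ → Bool) (κ → Bool) ℂ} (hV : V ∈ Matrix.unitaryGroup (κ → Bool) ℂ)
    (g : (κ → Bool) → ℝ) {tA tB δ ε : ℝ} (hsep : 2 * δ < |tA - tB|)
    (hAccA : 1 - ε ≤ ∑ x, outcomeProb (V * A * Vᴴ) x * (if |g x - tA| ≤ δ then 1 else 0))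
    (hAccB : 1 - ε ≤ ∑ x, outcomeProb (V * B * Vᴴ) x * (if |g x - tB| ≤ δ then 1 else 0)) :
    1 - 2 * ε ≤ Real.sqrt (a / 2) + Real.sqrt (b / 2) := by
  set fA : (κ → Bool) → ℝ := fun x => if |g x - tA| ≤ δ then 1 else 0 with hfA
  set fB : (κ → Bool) → ℝ := fun x => if |g x - tB| ≤ δ then 1 else 0 with hfB
  have hfA0 : ∀ x, 0 ≤ fA x := fun x => by simp only [hfA]; split_ifs <;> norm_num
  have hfA1 : ∀ x, fA x ≤ 1 := fun x => by simp only [hfA]; split_ifs <;> norm_num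
  -- the windows are disjoint: `fA + fB ≤ 1`
  have hdisj : ∀ x, fA x + fB x ≤ 1 := by
    intro x
    simp only [hfA, hfB]
    by_cases h1 : |g x - tA| ≤ δ
    · by_cases h2 : |g x - tB| ≤ δ
      · exfalso
        have : |tA - tB| ≤ 2 * δ := by
          calc |tA - tB| = |(g x - tB) - (g x - tA)| := by ring_nf
            _ ≤ |g x - tB| + |g x - tA| := abs_sub _ _
            _ ≤ 2 * δ := by linarith
        linarith
      · simp [h1, h2]
    · by_cases h2 : |g x - tB| ≤ δ <;> simp [h1, h2]
  have hB' := isDensity_unitary_conj hV hB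
  have hq0 := outcomeProb_nonneg hB'
  have hq1 := sum_outcomeProb hB'
  -- under `B`, the `A`-window has probability `≤ ε`
  have hRej : ∑ x, outcomeProb (V * B * Vᴴ) x * fA x ≤ ε := by
    have hle : ∑ x, outcomeProb (V * B * Vᴴ) x * fA x + ∑ x, outcomeProb (V * B * Vᴴ) x * fB x ≤ 1 := by
      rw [← Finset.sum_add_distrib, ← hq1]
      refine Finset.sum_le_sum fun x _ => ?_
      have := mul_le_mul_of_nonneg_left (hdisj x) (hq0 x)
      linarith [this]
    have hB1 : 1 - ε ≤ ∑ x, outcomeProb (V * B * Vᴴ) x * fB x := hAccB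
    linarith
  have h := jointTest_gap_le_of_budget hA hB ha hb hV fA hfA0 hfA1
  have := le_abs_self (∑ x, outcomeProb (V * A * Vᴴ) x * fA x - ∑ x, outcomeProb (V * B * Vᴴ) x * fA x)
  have hA1 : 1 - ε ≤ ∑ x, outcomeProb (V * A * Vᴴ) x * fA x := hAccA
  linarith

/-- **Copies floor for `(δ, ε)`-estimation.** Any joint read-out of `N` noisy circuit outputs whose real-valued
answer `g` is `δ`-accurate with probability `≥ 1−ε` on BOTH of two admissible experiments (arm A / arm B, e.g. the
same circuits on two inputs) whose target values differ by more than `2δ` needs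
`1 − 2ε ≤ √(n ln 2 · B_A/2) + √(n ln 2 · B_B/2)`; uniformly, `N ≥ (1−2ε)²/(2 ln 2 · n · (1−p)^d)` copies
(`coherentCopies_floor_uniform` with the window indicator) — whatever coherent processing produced `g`.
[cite: TakagiTajimaGu2023, Theorem 3 (hypothesis "(1) with δ ≥ 0, 0 ≤ ε ≤ 1/2, D_O(ρ,σ) ≥ 2δ")] -/
theorem coherentCopies_floor_of_accuracy (N : ℕ)
    {p : Fin N → ℝ} (hp0 : ∀ k, 0 ≤ p k) (hp1 : ∀ k, p k ≤ 1) (d : Fin N → ℕ)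
    {U : (k : Fin N) → Fin (d k) → Matrix (ι → Bool) (ι → Bool) ℂ} (hU : ∀ k t, U k t ∈ Matrix.unitaryGroup (ι → Bool) ℂ)
    {ρ : Fin N → Matrix (ι → Bool) (ι → Bool) ℂ} (hρ : ∀ k, IsDensity (ρ k))
    {p' : Fin N → ℝ} (hp0' : ∀ k, 0 ≤ p' k) (hp1' : ∀ k, p' k ≤ 1) (d' : Fin N → ℕ)
    {U' : (k : Fin N) → Fin (d' k) → Matrix (ι → Bool) (ι → Bool) ℂ} (hU' : ∀ k t, U' k t ∈ Matrix.unitaryGroup (ι → Bool) ℂ)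
    {ρ' : Fin N → Matrix (ι → Bool) (ι → Bool) ℂ} (hρ' : ∀ k, IsDensity (ρ' k))
    {V : Matrix ((Fin N × ι) → Bool) ((Fin N × ι) → Bool) ℂ} (hV : V ∈ Matrix.unitaryGroup ((Fin N × ι) → Bool) ℂ)
    (g : ((Fin N × ι) → Bool) → ℝ) {tA tB δ ε : ℝ} (hsep : 2 * δ < |tA - tB|)
    (hAccA : 1 - ε ≤ ∑ x, outcomeProb (V * noisyCopies N p d U ρ * Vᴴ) x * (if |g x - tA| ≤ δ then 1 else 0))
    (hAccB : 1 - ε ≤ ∑ x, outcomeProb (V * noisyCopies N p' d' U' ρ' * Vᴴ) x * (if |g x - tB| ≤ δ then 1 else 0)) :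
    1 - 2 * ε ≤ Real.sqrt (Fintype.card ι * Real.log 2 * (∑ k, (1 - p k) ^ d k) / 2) +
      Real.sqrt (Fintype.card ι * Real.log 2 * (∑ k, (1 - p' k) ^ d' k) / 2) :=
  floor_of_accuracy (isDensity_noisyCopies N hp0 hp1 d hU hρ) (isDensity_noisyCopies N hp0' hp1' d' hU' hρ')
    (deficiency_noisyCopies_le N hp0 hp1 d hU hρ) (deficiency_noisyCopies_le N hp0' hp1' d' hU' hρ') hV g hsep hAccA hAccB

/-! ### §5 The printed sharp rate as a written-out hypothesis (conditional record; nothing else consumes it) -/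

/-- **Sharp copies budget (conditional).** Under the printed one-layer contraction by `(1−p)²` — the hypothesis of the
tree's `deficiencyCeiling_sharp_of`, NOT proved in the tree — the budget improves to `n ln 2 · Σ_k (1−p_k)^{2 d_k}`.
[cite: TakagiTajimaGu2023, Appendix F eqs. (F5)–(F7) ((1−γ)^{2L})] [cite: MullerHermesFrancaWolf2016, §6 (α₁ = 1)] -/
theorem deficiency_noisyCopies_sharp_of
    (h : ∀ (ι : Type) [Fintype ι] [DecidableEq ι] (p : ℝ), 0 ≤ p → p ≤ 1 →
      ∀ ρ : Matrix (ι → Bool) (ι → Bool) ℂ, IsDensity ρ →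
        entropyDeficiency (depolarizeAll (p : ℂ) ρ) ≤ (1 - p) ^ 2 * entropyDeficiency ρ)
    (N : ℕ) {p : Fin N → ℝ} (hp0 : ∀ k, 0 ≤ p k) (hp1 : ∀ k, p k ≤ 1)
    (d : Fin N → ℕ) {U : (k : Fin N) → Fin (d k) → Matrix (ι → Bool) (ι → Bool) ℂ}
    (hU : ∀ k t, U k t ∈ Matrix.unitaryGroup (ι → Bool) ℂ)
    {ρ : Fin N → Matrix (ι → Bool) (ι → Bool) ℂ} (hρ : ∀ k, IsDensity (ρ k)) :
    entropyDeficiency (noisyCopies N p d U ρ) ≤ Fintype.card ι * Real.log 2 * ∑ k, (1 - p k) ^ (2 * d k) := by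
  have hσ : ∀ k, IsDensity (noisyEvolve (p k : ℂ) (d k) (U k) (ρ k)) :=
    fun k => isDensity_noisyEvolve (hp0 k) (hp1 k) (d k) (U k) (hU k) (hρ k)
  rw [noisyCopies, entropyDeficiency_nCopyState N _ hσ, Finset.mul_sum]
  refine Finset.sum_le_sum fun k _ => ?_
  have h1 := deficiencyCeiling_sharp_of h (hp0 k) (hp1 k) (d k) (U k) (hU k) (ρ k) (hρ k)
  have h2 := entropyDeficiency_le (hρ k)
  have h3 : 0 ≤ (1 - p k) ^ (2 * d k) := pow_nonneg (by linarith [hp1 k]) _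
  calc entropyDeficiency (noisyEvolve (p k : ℂ) (d k) (U k) (ρ k))
      ≤ (1 - p k) ^ (2 * d k) * entropyDeficiency (ρ k) := h1
    _ ≤ (1 - p k) ^ (2 * d k) * (Fintype.card ι * Real.log 2) := mul_le_mul_of_nonneg_left h2 h3
    _ = Fintype.card ι * Real.log 2 * (1 - p k) ^ (2 * d k) := by ring

/-- **Sharp copies floor (conditional) — the printed display letter for letter**: under the `(1−p)²` one-layer
hypothesis, `(1−2ε)² ≤ 2 · n ln 2 · N · (1−p)^{2d}`, i.e. `N ≥ (1−2ε)²/(2 ln(2) n (1−p)^{2d})` = the print's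
`N ≥ (1−2ε)²/(2 ln(2) M (1−γ)^{2L})`. [cite: TakagiTajimaGu2023, Theorem 3 eq. (5)] -/
theorem coherentCopies_floor_sharp_of
    (h : ∀ (ι : Type) [Fintype ι] [DecidableEq ι] (p : ℝ), 0 ≤ p → p ≤ 1 →
      ∀ ρ : Matrix (ι → Bool) (ι → Bool) ℂ, IsDensity ρ →
        entropyDeficiency (depolarizeAll (p : ℂ) ρ) ≤ (1 - p) ^ 2 * entropyDeficiency ρ)
    (N : ℕ) {p : ℝ} (hp0 : 0 ≤ p) (hp1 : p ≤ 1) (d : ℕ)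
    {U : Fin N → Fin d → Matrix (ι → Bool) (ι → Bool) ℂ} (hU : ∀ k t, U k t ∈ Matrix.unitaryGroup (ι → Bool) ℂ)
    {ρ : Fin N → Matrix (ι → Bool) (ι → Bool) ℂ} (hρ : ∀ k, IsDensity (ρ k))
    {U' : Fin N → Fin d → Matrix (ι → Bool) (ι → Bool) ℂ} (hU' : ∀ k t, U' k t ∈ Matrix.unitaryGroup (ι → Bool) ℂ)
    {ρ' : Fin N → Matrix (ι → Bool) (ι → Bool) ℂ} (hρ' : ∀ k, IsDensity (ρ' k))
    {V : Matrix ((Fin N × ι) → Bool) ((Fin N × ι) → Bool) ℂ} (hV : V ∈ Matrix.unitaryGroup ((Fin N × ι) → Bool) ℂ)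
    (f : ((Fin N × ι) → Bool) → ℝ) (hf0 : ∀ x, 0 ≤ f x) (hf1 : ∀ x, f x ≤ 1) {ε : ℝ} (hε : ε ≤ 1 / 2)
    (hAcc : 1 - ε ≤ ∑ x, outcomeProb (V * noisyCopies N (fun _ => p) (fun _ => d) U ρ * Vᴴ) x * f x)
    (hRej : ∑ x, outcomeProb (V * noisyCopies N (fun _ => p) (fun _ => d) U' ρ' * Vᴴ) x * f x ≤ ε) :
    (1 - 2 * ε) ^ 2 ≤ 2 * (Fintype.card ι * Real.log 2) * N * (1 - p) ^ (2 * d) := by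
  have hA := isDensity_noisyCopies N (fun _ => hp0) (fun _ => hp1) (fun _ => d) hU hρ
  have hB := isDensity_noisyCopies N (fun _ => hp0) (fun _ => hp1) (fun _ => d) hU' hρ'
  have ha := deficiency_noisyCopies_sharp_of h N (fun _ => hp0) (fun _ => hp1) (fun _ => d) hU hρ
  have hb := deficiency_noisyCopies_sharp_of h N (fun _ => hp0) (fun _ => hp1) (fun _ => d) hU' hρ'
  simp only [Finset.sum_const, Finset.card_univ, Fintype.card_fin, nsmul_eq_mul] at ha hb
  have hg := jointTest_gap_le_of_budget hA hB ha hb hV f hf0 hf1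
  have := le_abs_self (∑ x, outcomeProb (V * noisyCopies N (fun _ => p) (fun _ => d) U ρ * Vᴴ) x * f x -
    ∑ x, outcomeProb (V * noisyCopies N (fun _ => p) (fun _ => d) U' ρ' * Vᴴ) x * f x)
  set X : ℝ := Fintype.card ι * Real.log 2 * (N * (1 - p) ^ (2 * d)) / 2 with hX
  have hX0 : 0 ≤ X := by
    have := Real.log_pos one_lt_two
    have : 0 ≤ (1 - p) ^ (2 * d) := pow_nonneg (by linarith) _
    positivity
  have h4 := sq_le_four_mul hX0 hε (by linarith)
  rw [hX] at h4
  linarith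

/-! ### §6 Numbers (the honest reading: vacuous below the useless depth, exponential beyond it) -/

/-- `(1 − p)^d ≤ e^{−pd}`. [cite: FrancaGarciaPatron2021, Supplementary §6.1.1 (N_max; (1−p)^N ≤ e^{−pN})] -/
private theorem one_sub_pow_le_exp {p : ℝ} (hp1 : p ≤ 1) (d : ℕ) : (1 - p) ^ d ≤ Real.exp (-(p * d)) := by
  have h1 : 1 - p ≤ Real.exp (-p) := by have := Real.add_one_le_exp (-p); linarith
  calc (1 - p) ^ d ≤ (Real.exp (-p)) ^ d := pow_le_pow_left₀ (by linarith) h1 d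
    _ = Real.exp (-(p * d)) := by rw [← Real.exp_nat_mul]; ring_nf

/-- **Numbers, `n = 100` qubits, `p = 10⁻²`, `ε = 1/10`, depth `d = 1000` (`p·d = 10`):** the uniform floor
`(1−2ε)² ≤ 2 n ln 2 · N (1−p)^d` forces `N ≥ 102` copies — however coherently they are processed. (At the same
`n, p, ε` the floor is below `1`, i.e. says nothing, for every `d ≤ 535`: it only bites beyond the useless depth of
the single-copy ceiling, and then grows like `e^{pd}(1−2ε)²/(2 n ln 2)`; under the sharp-rate hypothesis the same
depth gives `N ≥ 2.2·10⁶`.) [cite: TakagiTajimaGu2023, Theorem 3 eq. (5) (exponential growth with the depth)] -/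
theorem numbers100 {N : ℕ}
    (h : (1 - 2 * (1 / 10 : ℝ)) ^ 2 ≤ 2 * ((100 : ℕ) * Real.log 2) * N * (1 - (1 / 100 : ℝ)) ^ 1000) : 102 ≤ N := by
  by_contra hN
  have hN' : (N : ℝ) ≤ 101 := by exact_mod_cast Nat.lt_succ_iff.mp (not_le.mp hN)
  have h2 : Real.log 2 ≤ 0.6931471808 := Real.log_two_lt_d9.le
  have he : (1 - (1 / 100 : ℝ)) ^ 1000 ≤ 1 / (2.7182818283 : ℝ) ^ 10 := by
    have h1 := one_sub_pow_le_exp (p := (1 / 100 : ℝ)) (by norm_num) 1000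
    have h1' : Real.exp (-((1 / 100 : ℝ) * (1000 : ℕ))) = Real.exp (-10) := by norm_num
    rw [h1'] at h1
    refine h1.trans ?_
    rw [Real.exp_neg, one_div]
    refine inv_anti₀ (by positivity) ?_
    calc (2.7182818283 : ℝ) ^ 10 ≤ (Real.exp 1) ^ 10 := pow_le_pow_left₀ (by norm_num) Real.exp_one_gt_d9.le 10
      _ = Real.exp 10 := by rw [← Real.exp_nat_mul]; norm_num
  generalize hq : (1 - (1 / 100 : ℝ)) ^ 1000 = q at h he
  have hq0 : 0 ≤ q := by rw [← hq]; positivity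
  have hl0 : 0 < Real.log 2 := Real.log_pos one_lt_two
  have h3 : 2 * ((100 : ℕ) * Real.log 2) * N * q ≤ 2 * (100 * 0.6931471808) * 101 * (1 / (2.7182818283 : ℝ) ^ 10) := by
    push_cast
    gcongr
  have h4 : 2 * (100 * 0.6931471808) * 101 * (1 / (2.7182818283 : ℝ) ^ 10) < (1 - 2 * (1 / 10 : ℝ)) ^ 2 := by
    norm_num
  linarith

/-- **Vacuity below the useless depth**, same `n, p, ε`, at `d = 500` (`p·d = 5`): `2 n ln 2 (1−p)^d > (1−2ε)²` (via `(1−p)^{100} ≥ 0.36`), so the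
floor `(1−2ε)²/(2 n ln 2 (1−p)^d)` is `< 1` and excludes nothing. [cite: TakagiTajimaGu2023, Theorem 3 eq. (5)] -/
theorem numbers100_vacuous :
    (1 - 2 * (1 / 10 : ℝ)) ^ 2 < 2 * ((100 : ℕ) * Real.log 2) * 1 * (1 - (1 / 100 : ℝ)) ^ 500 := by
  have h2 : 0.6931471803 ≤ Real.log 2 := Real.log_two_gt_d9.le
  have hq1 : (36 / 100 : ℝ) ≤ (1 - (1 / 100 : ℝ)) ^ 100 := by norm_num
  have hq : (36 / 100 : ℝ) ^ 5 ≤ (1 - (1 / 100 : ℝ)) ^ 500 := by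
    rw [show ((1 : ℝ) - 1 / 100) ^ 500 = ((1 - 1 / 100) ^ 100) ^ 5 by rw [← pow_mul]]
    exact pow_le_pow_left₀ (by norm_num) hq1 5
  generalize hqq : (1 - (1 / 100 : ℝ)) ^ 500 = q at hq
  have h3 : 2 * (100 * 0.6931471803) * 1 * ((36 / 100 : ℝ) ^ 5) ≤
      2 * ((100 : ℕ) * Real.log 2) * 1 * q := by
    push_cast
    gcongr
  have h4 : (1 - 2 * (1 / 10 : ℝ)) ^ 2 < 2 * (100 * 0.6931471803) * 1 * ((36 / 100 : ℝ) ^ 5) := by norm_num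
  linarith

end CoherentCopiesFloor

end Literature.Computability.QuantumComplexity

end
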